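import Literature.Algebra.Lie.LefschetzModuleWeylOperator
import Literature.Algebra.Lie.LefschetzModuleTensorFactor
import Mathlib.RingTheory.TensorProduct.Maps
import HarnessLib

/-!
# André's §1.3 sorites on `X × Y`: primitive tensors, the Weyl operator and the Hodge involution of a tensor product
# (Lemme 1.3.1, Lemme 1.3.2: `*_H x ⊗ *_H y = (−1)^{ij} *_H (x ⊗ y)`)

Topic `Literature/Algebra/Lie` (namespace `Literature.Algebra.Lie`).  Lane `lit-hodgefound` (Track 2 foundations library),
prover seat `lit-hodgefound-p34` (generation 31, row g31-#2), the sequel of `LefschetzModuleWeylOperator.lean` (g31-#1: the Weyl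
operator `w = exp(f) exp(−e) exp(f)`, André's `*_H` with the factor `k!/(d−j+k)!`, `*_H = (−1)^{d + C(n,2)} w` on `Hⁿ`) on the tensor
product of two Lefschetz modules (`LefschetzModule.lean` §8, row A1-90 of seat `lit-hodgefound-skel-1`: `HasLefschetzProperty.tensor`,
`dual_tensor` — `(M ⊗ N, h ⊗ 1 + 1 ⊗ h', e ⊗ 1 + 1 ⊗ e')` is a Lefschetz module with partner `f ⊗ 1 + 1 ⊗ f'`; and
`LefschetzModuleTensorFactor.lean`: the binomial formula `rTensor_add_lTensor_pow_tmul`, homogeneous pure tensors span).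
PROVED theorems only (no definition, no named fact, no `sorry`, no instance, no notation; D-0026 net debt `0`).

## Source, VERBATIM (Y. André, *Pour une théorie inconditionnelle des motifs*, Publ. Math. IHÉS 83 (1996), §1.3, pp. 12–13 =
held `paper:doi-10-1007-bf02698643` p0009 L34–L44, p0010 L5–L44; OCR of the Numdam scan, displayed formulas partly garbled)

"1.3. Nous donnons maintenant quelques sorites concernant les involutions `*_L` et `*_H` sur un produit `X × Y` de `K`-schémas
projectifs lisses, équidimensionnels de dimensions respectives `d` et `d'`. L'isomorphisme (d'algèbres graduées) de Künneth :
`H*(X × Y) ≅ H*(X) ⊗ H*(Y)` devient un isomorphisme de `𝔰𝔩₂`-modules si l'on munit `X × Y` du faisceau inversible ample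
`pr_X* 𝓛_X ⊗ pr_Y* 𝓛_Y`. Par le formalisme des `𝔰𝔩₂`-triplets (cf. [D80] 1.6.12.1 […]), on déduit de l'isomorphisme de
`𝔰𝔩₂`-représentations `Sⁱ ⊗ Sʲ ≅ ⊕ S^{i+j−2k}` (Clebsch–Gordan) un isomorphisme canonique `P*(X × Y) ≅ ⊕ […] P*(X) ⊗ P*(Y)`; l'inclusion
`P*(X) ⊗ P*(Y) ⊆ P*(X × Y)` fournie par cet isomorphisme est restriction de l'isomorphisme de Künneth.
**Lemme 1.3.1.** — Considérons `Pⁱ(X) ⊗ Pʲ(Y)` comme un sous-espace de `P^{i+j}(X × Y)` et `L^{d−i}Pⁱ(X) ⊗ L^{d'−j}Pʲ(Y)` comme un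
sous-espace de `L^{d−i+d'−j}P^{i+j}(X × Y)`. Alors les isomorphismes `L^{d−i}Pⁱ(X) ⊗ L^{d'−j}Pʲ(Y) → Pⁱ(X) ⊗ Pʲ(Y)` donnés par l'involution
de Lefschetz (resp. Hodge) relative à `X × Y` d'une part, par `[c ·] *_{L,X} ⊗ *_{L,Y}` (resp. `(−1)^{ij} *_{H,X} ⊗ *_{H,Y}`) d'autre part,
coïncident. En effet, l'inverse de cet isomorphisme est `L^{d+d'−i−j}_{X×Y}` [qui] coïncide avec `[c ·] L^{d−i}_X ⊗ L^{d'−j}_Y` sur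
`Pⁱ(X) ⊗ Pʲ(Y)`." (The rational constant `c` of the Lefschetz clause is unreadable in the scan; it is COMPUTED here:
`c = (d−i+d'−j)! / ((d−i)!(d'−j)!)`, `lefschetzInvolution_tensor_apply_top`, `pow_rTensor_add_lTensor_apply_tmul_primitive`.)
**Lemme 1.3.2.** — "Il existe des nombres rationnels `r` tels que pour tous éléments `x ∈ Hᵖ(X)`, `y ∈ H^q(Y)`, on ait : `*_L x ⊗ *_L y =
Σ r {…}`. Pour l'involution de Hodge, on a la formule **`*_H x ⊗ *_H y = (−1)^{ij} *_H (x ⊗ y)`** [`x ∈ Hⁱ(X)`, `y ∈ Hʲ(Y)`]. […] La formule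
pour l'involution de Hodge découle de son interprétation en termes de l'élément `(0 1 ; −1 0)` de `SL₂`."

## Rendering and proof

`X`, `Y` ↦ Lefschetz modules `(M, h, e)`, `(N, h', e')` (finite-dimensional, characteristic `0`), `H*(X × Y)` ↦ `M ⊗ N` with
`H = h ⊗ 1 + 1 ⊗ h'`, `E = e ⊗ 1 + 1 ⊗ e'` (A1-90), whose partner is `F = f ⊗ 1 + 1 ⊗ f'` (`dual_tensor`) and whose "`d`" is `d + d'`;
`Hⁿ(X) = M_{n−d}`.  The Hodge formula is proved exactly as printed: the Weyl operator of g31-#1 is GROUP-LIKE,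
`w_{M ⊗ N} = w_M ⊗ w_N` (`exp` of a sum of the commuting nilpotents `f ⊗ 1`, `1 ⊗ f'` is the product of the exponentials, and
`exp(f ⊗ 1) = exp(f) ⊗ 1`), and `*_H = (−1)^{d + C(n,2)} w` on `Hⁿ` (g31-#1) with `C(n+n', 2) = C(n, 2) + n n' + C(n', 2)`.

## Contents (all proved; `F`, `H`, `E` as above, `LT = L.tensor hgr L' hgr'`)

* §1 (Lemme 1.3.1) **`tmul_mem_primitiveSpace`** (`P_{-a}(M) ⊗ P_{-b}(N) ⊆ P_{-(a+b)}(M ⊗ N)`: "l'inclusion `P(X) ⊗ P(Y) ⊆ P(X × Y)` […]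
  est restriction de l'isomorphisme de Künneth"), **`pow_rTensor_add_lTensor_apply_tmul_primitive`** (`E^{a+b}(p ⊗ q) = C(a+b, a) ·
  eᵃp ⊗ e'ᵇq`: "`L^{d+d'−i−j}_{X×Y}` coïncide avec `c · L^{d−i}_X ⊗ L^{d'−j}_Y` sur `Pⁱ(X) ⊗ Pʲ(Y)`"), **`lefschetzInvolution_tensor_apply_top`**
  (`*_{L,M⊗N}(eᵃp ⊗ e'ᵇq) = C(a+b, a)⁻¹ · (*_L eᵃp ⊗ *_L e'ᵇq) = C(a+b,a)⁻¹ · p ⊗ q`), `depth_rTensor_add_lTensor_le`.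
* §2 `exp_rTensor`, `exp_lTensor`, **`exp_rTensor_add_lTensor`** (`exp(a ⊗ 1 + 1 ⊗ b) = exp a ⊗ exp b`), **`weylOperator_tensor`**
  (`w_{M⊗N} = w_M ⊗ w_N`), `weylOperator_tensor_tmul`.
* §3 (Lemme 1.3.2, Hodge) `choose_two_add`, **`andreHodgeInvolution_tensor_tmul`** (`*_H (x ⊗ y) = (−1)^{nn'} *_H x ⊗ *_H y` for
  `x ∈ Hⁿ`, `y ∈ H^{n'}`), **`andreHodgeInvolution_tmul_andreHodgeInvolution`** (the printed form `*_H x ⊗ *_H y = (−1)^{nn'} *_H (x ⊗ y)`),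
  `andreHodgeInvolution_tensor_apply_pow_primitive` (the Hodge clause of Lemme 1.3.1: `(−1)^{ij}`, `i`, `j` the degrees of the
  primitive classes).

## SCOPE (not formalised here)

The `*_L`-clause of Lemme 1.3.2 (the universal rational coefficients `r`) — its qualitative form for a Weil cohomology is the tree's
`Motivated/LefschetzStarExternalProduct.lean` (`WeilCohomology.star_externalCup_star_mem_span`), announced by name, not imported;
the Clebsch–Gordan decomposition `P*(X × Y) ≅ ⊕ P*(X) ⊗ P*(Y)` itself (only the inclusion of Lemme 1.3.1 is needed and proved).

## References

* [Andre1996Motifs] Y. André, *Pour une théorie inconditionnelle des motifs*, Publ. Math. IHÉS 83 (1996) 5–49, §1.3 (pp. 12–13: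
  Lemme 1.3.1, Lemme 1.3.2), §1.2 (p. 11).
* [LooijengaLunts1997] E. Looijenga, V. A. Lunts, *A Lie algebra attached to a projective variety*, Invent. Math. 129 (1997) 361–412,
  §1 (1.1) (tensor products of Lefschetz modules).
* [Deligne1980WeilII] P. Deligne, *La conjecture de Weil. II*, Publ. Math. IHÉS 52 (1980), (1.6.12.1) — as cited by André ("[D80]").
-/

noncomputable section

namespace Literature.Algebra.Lie

open Module Function Set
open scoped Nat TensorProduct
open HasLefschetzProperty (primitiveSpace mem_primitiveSpace_iff)

variable {K : Type*} [Field K] [CharZero K] {M N : Type*} [AddCommGroup M] [Module K M] [FiniteDimensional K M]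
  [AddCommGroup N] [Module K N] [FiniteDimensional K N] {h e : Module.End K M} {h' e' : Module.End K N}

/-! ### §1 Lemme 1.3.1: primitive tensors and the top of their string -/

omit [CharZero K] [FiniteDimensional K M] [FiniteDimensional K N] in
/-- **`P_{-a}(M) ⊗ P_{-b}(N) ⊆ P_{-(a+b)}(M ⊗ N)`** — the tensor of two primitive (lowest-weight) vectors is primitive for
`e ⊗ 1 + 1 ⊗ e'` ("l'inclusion `P*(X) ⊗ P*(Y) ⊆ P*(X × Y)` fournie par cet isomorphisme [Clebsch–Gordan] est restriction de l'isomorphisme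
de Künneth"): in `E^{a+b+1}(p ⊗ q) = Σ C(a+b+1, i) eⁱp ⊗ e'^{a+b+1−i}q` every term has `i > a` or `a+b+1−i > b`.
[cite: Andre1996Motifs, §1.3 (p. 12) and Lemme 1.3.1 (p. 13)] -/
theorem tmul_mem_primitiveSpace {a b : ℕ} {p : M} {q : N} (hp : p ∈ primitiveSpace h e a) (hq : q ∈ primitiveSpace h' e' b) :
    p ⊗ₜ[K] q ∈ primitiveSpace (h.rTensor N + h'.lTensor M) (e.rTensor N + e'.lTensor M) (a + b) := by
  rw [mem_primitiveSpace_iff] at hp hq ⊢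
  refine ⟨?_, ?_⟩
  · have h1 := tmul_mem_degreeSpace hp.1 hq.1
    convert h1 using 2
    push_cast
    ring
  · rw [rTensor_add_lTensor_pow_tmul]
    refine Finset.sum_eq_zero fun i _ ↦ ?_
    rcases le_or_gt (a + 1) i with hia | hia
    · have h0 : (e ^ i) p = 0 := by
        rw [show i = (i - (a + 1)) + (a + 1) by omega, pow_add, Module.End.mul_apply, hp.2, map_zero]
      rw [h0, TensorProduct.zero_tmul, smul_zero]
    · have h0 : (e' ^ (a + b + 1 - i)) q = 0 := by
        rw [show a + b + 1 - i = (a - i) + (b + 1) by omega, pow_add, Module.End.mul_apply, hq.2, map_zero]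
      rw [h0, TensorProduct.tmul_zero, smul_zero]

omit [CharZero K] [FiniteDimensional K M] [FiniteDimensional K N] in
/-- **The top of the string through `p ⊗ q`: `E^{a+b}(p ⊗ q) = C(a+b, a) · eᵃ p ⊗ e'ᵇ q`** for `p ∈ P_{-a}`, `q ∈ P_{-b}` ("l'inverse de
cet isomorphisme est `L^{d+d'−i−j}_{X×Y}` [qui] coïncide avec `c · L^{d−i}_X ⊗ L^{d'−j}_Y` sur `Pⁱ(X) ⊗ Pʲ(Y)`", `c = C(d+d'−i−j, d−i)`).
[cite: Andre1996Motifs, §1.3 Lemme 1.3.1 (p. 13, proof)] -/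
theorem pow_rTensor_add_lTensor_apply_tmul_primitive {a b : ℕ} {p : M} {q : N} (hp : p ∈ primitiveSpace h e a)
    (hq : q ∈ primitiveSpace h' e' b) :
    ((e.rTensor N + e'.lTensor M) ^ (a + b)) (p ⊗ₜ[K] q) = (((a + b).choose a : ℕ) : K) • ((e ^ a) p ⊗ₜ[K] (e' ^ b) q) := by
  rw [rTensor_add_lTensor_pow_tmul, Finset.sum_eq_single a]
  · rw [Nat.add_sub_cancel_left]
  · intro i _ hia
    rcases lt_or_gt_of_ne hia with hlt | hgt
    · have h0 : (e' ^ (a + b - i)) q = 0 := by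
        rw [show a + b - i = (a - i - 1) + (b + 1) by omega, pow_add, Module.End.mul_apply, (mem_primitiveSpace_iff.1 hq).2, map_zero]
      rw [h0, TensorProduct.tmul_zero, smul_zero]
    · have h0 : (e ^ i) p = 0 := by
        rw [show i = (i - (a + 1)) + (a + 1) by omega, pow_add, Module.End.mul_apply, (mem_primitiveSpace_iff.1 hp).2, map_zero]
      rw [h0, TensorProduct.zero_tmul, smul_zero]
  · intro ha
    exact absurd (Finset.mem_range.2 (by omega)) ha

namespace HasLefschetzProperty

/-- **Lemme 1.3.1 (Lefschetz clause): on the top `eᵃ P_{-a} ⊗ e'ᵇ P_{-b}` of a product string the Lefschetz involution of `M ⊗ N` and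
`*_{L,M} ⊗ *_{L,N}` coincide up to the constant `c⁻¹ = a! b!/(a+b)!`**: `*_{L,M⊗N}(eᵃp ⊗ e'ᵇq) = C(a+b, a)⁻¹ · (*_L eᵃp ⊗ *_L e'ᵇq)`
(both sides are multiples of `p ⊗ q`). [cite: Andre1996Motifs, §1.3 Lemme 1.3.1 (p. 13)] -/
theorem lefschetzInvolution_tensor_apply_top (L : HasLefschetzProperty h e) (hgr : IsZGrading h) (L' : HasLefschetzProperty h' e')
    (hgr' : IsZGrading h') {a b : ℕ} {p : M} {q : N} (hp : p ∈ primitiveSpace h e a) (hq : q ∈ primitiveSpace h' e' b) :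
    (L.tensor hgr L' hgr').lefschetzInvolution (isZGrading_rTensor_add_lTensor hgr hgr') ((e ^ a) p ⊗ₜ[K] (e' ^ b) q) =
      (((a + b).choose a : ℕ) : K)⁻¹ •
        (L.lefschetzInvolution hgr ((e ^ a) p) ⊗ₜ[K] L'.lefschetzInvolution hgr' ((e' ^ b) q)) := by
  have hc : (((a + b).choose a : ℕ) : K) ≠ 0 := Nat.cast_ne_zero.2 (Nat.choose_pos (Nat.le_add_right a b)).ne'
  have h1 : (e ^ a) p ⊗ₜ[K] (e' ^ b) q =
      (((a + b).choose a : ℕ) : K)⁻¹ • ((e.rTensor N + e'.lTensor M) ^ (a + b)) (p ⊗ₜ[K] q) := by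
    rw [pow_rTensor_add_lTensor_apply_tmul_primitive hp hq, smul_smul, inv_mul_cancel₀ hc, one_smul]
  rw [h1, map_smul, (L.tensor hgr L' hgr').isStringReversal_lefschetzInvolution (isZGrading_rTensor_add_lTensor hgr hgr')
    (tmul_mem_primitiveSpace hp hq) le_rfl, L.isStringReversal_lefschetzInvolution hgr hp le_rfl,
    L'.isStringReversal_lefschetzInvolution hgr' hq le_rfl, Nat.sub_self, Nat.sub_self, Nat.sub_self, pow_zero, pow_zero, pow_zero,
    Module.End.one_apply, Module.End.one_apply, Module.End.one_apply]

/-- … in particular `*_{L,M⊗N}(eᵃp ⊗ e'ᵇq) = C(a+b, a)⁻¹ · p ⊗ q`. [cite: Andre1996Motifs, §1.3 Lemme 1.3.1 (p. 13)] -/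
theorem lefschetzInvolution_tensor_apply_top' (L : HasLefschetzProperty h e) (hgr : IsZGrading h) (L' : HasLefschetzProperty h' e')
    (hgr' : IsZGrading h') {a b : ℕ} {p : M} {q : N} (hp : p ∈ primitiveSpace h e a) (hq : q ∈ primitiveSpace h' e' b) :
    (L.tensor hgr L' hgr').lefschetzInvolution (isZGrading_rTensor_add_lTensor hgr hgr') ((e ^ a) p ⊗ₜ[K] (e' ^ b) q) =
      (((a + b).choose a : ℕ) : K)⁻¹ • (p ⊗ₜ[K] q) := by
  rw [L.lefschetzInvolution_tensor_apply_top hgr L' hgr' hp hq, L.isStringReversal_lefschetzInvolution hgr hp le_rfl,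
    L'.isStringReversal_lefschetzInvolution hgr' hq le_rfl, Nat.sub_self, Nat.sub_self, pow_zero, pow_zero, Module.End.one_apply,
    Module.End.one_apply]

/-- **The depth of a tensor product is at most the sum of the depths**: `(M ⊗ N)_n = 0` for `n > depth M + depth N` (the degree
part `(M ⊗ N)_n` is spanned by the `x ⊗ y`, `x ∈ M_a`, `y ∈ N_j`, `a + j = n`). [cite: LooijengaLunts1997, §1 (1.1) p. 4 L58–L63, L70–L72] -/
theorem depth_rTensor_add_lTensor_le (L : HasLefschetzProperty h e) (hgr : IsZGrading h) (L' : HasLefschetzProperty h' e')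
    (hgr' : IsZGrading h') : depth (h.rTensor N + h'.lTensor M) ≤ depth h + depth h' := by
  refine csSup_le' fun n hn ↦ ?_
  by_contra hlt
  refine hn ((Submodule.eq_bot_iff _).2 fun v hv ↦ ?_)
  have hv' := degreeSpace_rTensor_add_lTensor_le_span hgr hgr' (n : ℤ) hv
  refine (Submodule.span_le.2 ?_ : Submodule.span K _ ≤ (⊥ : Submodule K (M ⊗[K] N))) hv' |> (Submodule.mem_bot K).1
  rintro _ ⟨a, j, x, y, haj, hx, hy, rfl⟩
  rw [SetLike.mem_coe, Submodule.mem_bot]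
  rcases lt_or_ge (depth h : ℤ) a with ha | ha
  · obtain ⟨a', rfl⟩ : ∃ a' : ℕ, (a' : ℤ) = a := ⟨a.toNat, by omega⟩
    rw [L.degreeSpace_eq_bot_of_depth_lt (by exact_mod_cast ha), Submodule.mem_bot] at hx
    rw [hx, TensorProduct.zero_tmul]
  · have hj : (depth h' : ℤ) < j := by omega
    obtain ⟨j', rfl⟩ : ∃ j' : ℕ, (j' : ℤ) = j := ⟨j.toNat, by omega⟩
    rw [L'.degreeSpace_eq_bot_of_depth_lt (by exact_mod_cast hj), Submodule.mem_bot] at hy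
    rw [hy, TensorProduct.tmul_zero]

end HasLefschetzProperty

/-! ### §2 The Weyl operator is group-like: `w_{M ⊗ N} = w_M ⊗ w_N` -/

omit [FiniteDimensional K M] [FiniteDimensional K N] in
/-- The finite exponential with coefficients in `K` (Mathlib's `IsNilpotent.exp` for the `ℚ`-structure through `ℚ → K`). [folklore] -/
private theorem exp_eq_sum_of_pow_eq_zero_tensor {V : Type*} [AddCommGroup V] [Module K V] {a : Module.End K V} {n : ℕ}
    (ha : a ^ n = 0) :
    letI := Algebra.compHom (Module.End K V) (algebraMap ℚ K)
    IsNilpotent.exp a = ∑ i ∈ Finset.range n, ((i ! : ℕ) : K)⁻¹ • a ^ i := by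
  letI := Algebra.compHom (Module.End K V) (algebraMap ℚ K)
  rw [IsNilpotent.exp_eq_sum ha]
  refine Finset.sum_congr rfl fun i _ ↦ ?_
  rw [Algebra.compHom_smul_def, map_inv₀, map_natCast]

omit [CharZero K] [FiniteDimensional K M] [FiniteDimensional K N] in
/-- `e ⊗ 1` and `1 ⊗ e'` commute. [cite: LooijengaLunts1997, §1 (1.1) p. 4 L73–L76] -/
private theorem commute_rTensor_lTensor_aux (a : Module.End K M) (b : Module.End K N) : Commute (a.rTensor N) (b.lTensor M) := by
  change a.rTensor N * b.lTensor M = b.lTensor M * a.rTensor N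
  rw [Module.End.mul_eq_comp, Module.End.mul_eq_comp, LinearMap.rTensor_comp_lTensor, LinearMap.lTensor_comp_rTensor]

omit [FiniteDimensional K M] [FiniteDimensional K N] in
/-- **`exp(a ⊗ 1) = exp(a) ⊗ 1`** for a nilpotent `a`. [cite: Andre1996Motifs, §1.3 (p. 12: Künneth "devient un isomorphisme de 𝔰𝔩₂-modules")] -/
theorem exp_rTensor {a : Module.End K M} (ha : IsNilpotent a) :
    letI := Algebra.compHom (Module.End K M) (algebraMap ℚ K)
    letI := Algebra.compHom (Module.End K (M ⊗[K] N)) (algebraMap ℚ K)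
    IsNilpotent.exp (a.rTensor N) = (IsNilpotent.exp a).rTensor N := by
  letI := Algebra.compHom (Module.End K M) (algebraMap ℚ K)
  letI := Algebra.compHom (Module.End K (M ⊗[K] N)) (algebraMap ℚ K)
  obtain ⟨n, hn⟩ := ha
  have hn' : (a.rTensor N) ^ n = 0 := by rw [LinearMap.rTensor_pow, hn, LinearMap.rTensor_zero]
  rw [exp_eq_sum_of_pow_eq_zero_tensor hn', exp_eq_sum_of_pow_eq_zero_tensor hn, ← LinearMap.coe_rTensorHom, map_sum]
  refine Finset.sum_congr rfl fun i _ ↦ ?_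
  rw [map_smul, LinearMap.coe_rTensorHom, LinearMap.rTensor_pow]

omit [FiniteDimensional K M] [FiniteDimensional K N] in
/-- **`exp(1 ⊗ b) = 1 ⊗ exp(b)`** for a nilpotent `b`. [cite: Andre1996Motifs, §1.3 (p. 12)] -/
theorem exp_lTensor {b : Module.End K N} (hb : IsNilpotent b) :
    letI := Algebra.compHom (Module.End K N) (algebraMap ℚ K)
    letI := Algebra.compHom (Module.End K (M ⊗[K] N)) (algebraMap ℚ K)
    IsNilpotent.exp (b.lTensor M) = (IsNilpotent.exp b).lTensor M := by
  letI := Algebra.compHom (Module.End K N) (algebraMap ℚ K)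
  letI := Algebra.compHom (Module.End K (M ⊗[K] N)) (algebraMap ℚ K)
  obtain ⟨n, hn⟩ := hb
  have hn' : (b.lTensor M) ^ n = 0 := by rw [LinearMap.lTensor_pow, hn, LinearMap.lTensor_zero]
  rw [exp_eq_sum_of_pow_eq_zero_tensor hn', exp_eq_sum_of_pow_eq_zero_tensor hn, ← LinearMap.coe_lTensorHom, map_sum]
  refine Finset.sum_congr rfl fun i _ ↦ ?_
  rw [map_smul, LinearMap.coe_lTensorHom, LinearMap.lTensor_pow]

omit [FiniteDimensional K M] [FiniteDimensional K N] in
/-- **`exp(a ⊗ 1 + 1 ⊗ b) = exp(a) ⊗ exp(b)`** for nilpotent `a`, `b` (`a ⊗ 1` and `1 ⊗ b` commute): the one-parameter subgroups of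
`SL₂ × SL₂` act on `H*(X) ⊗ H*(Y)` diagonally. [cite: Andre1996Motifs, §1.3 (p. 12–13: Künneth is an isomorphism of 𝔰𝔩₂-modules; "interprétation en termes de l'élément (0 1 ; −1 0) de SL₂")] -/
theorem exp_rTensor_add_lTensor {a : Module.End K M} {b : Module.End K N} (ha : IsNilpotent a) (hb : IsNilpotent b) :
    letI := Algebra.compHom (Module.End K M) (algebraMap ℚ K)
    letI := Algebra.compHom (Module.End K N) (algebraMap ℚ K)
    letI := Algebra.compHom (Module.End K (M ⊗[K] N)) (algebraMap ℚ K)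
    IsNilpotent.exp (a.rTensor N + b.lTensor M) = TensorProduct.map (IsNilpotent.exp a) (IsNilpotent.exp b) := by
  letI := Algebra.compHom (Module.End K M) (algebraMap ℚ K)
  letI := Algebra.compHom (Module.End K N) (algebraMap ℚ K)
  letI := Algebra.compHom (Module.End K (M ⊗[K] N)) (algebraMap ℚ K)
  have ha' : IsNilpotent (a.rTensor N) := by
    obtain ⟨n, hn⟩ := ha
    exact ⟨n, by rw [LinearMap.rTensor_pow, hn, LinearMap.rTensor_zero]⟩
  have hb' : IsNilpotent (b.lTensor M) := by
    obtain ⟨n, hn⟩ := hb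
    exact ⟨n, by rw [LinearMap.lTensor_pow, hn, LinearMap.lTensor_zero]⟩
  rw [IsNilpotent.exp_add_of_commute (commute_rTensor_lTensor_aux a b) ha' hb', exp_rTensor ha, exp_lTensor hb, Module.End.mul_eq_comp,
    LinearMap.rTensor_comp_lTensor]

namespace HasLefschetzProperty

/-- **The Weyl operator is group-like: `w_{M ⊗ N} = w_M ⊗ w_N`** — `exp(F) exp(−E) exp(F)` with `F = f ⊗ 1 + 1 ⊗ f'`, `E = e ⊗ 1 + 1 ⊗ e'`
factors as `(exp f ⊗ exp f')(exp(−e) ⊗ exp(−e'))(exp f ⊗ exp f')`; this is "son interprétation en termes de l'élément `(0 1 ; −1 0)` de `SL₂`":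
a group element acts on a tensor product of representations factor by factor. (`H = h ⊗ 1 + 1 ⊗ h' ≠ 0`, e.g. `N ≠ 0` and `h`
part of an `𝔰𝔩₂`-triple, `rTensor_add_lTensor_ne_zero`, makes `F` the partner of `E`.) [cite: Andre1996Motifs, §1.3 Lemme 1.3.2 (p. 13, proof)] -/
theorem weylOperator_tensor (L : HasLefschetzProperty h e) (hgr : IsZGrading h) (L' : HasLefschetzProperty h' e')
    (hgr' : IsZGrading h') (h0 : h.rTensor N + h'.lTensor M ≠ 0) :
    (L.tensor hgr L' hgr').weylOperator (isZGrading_rTensor_add_lTensor hgr hgr') =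
      TensorProduct.map (L.weylOperator hgr) (L'.weylOperator hgr') := by
  letI := Algebra.compHom (Module.End K M) (algebraMap ℚ K)
  letI := Algebra.compHom (Module.End K N) (algebraMap ℚ K)
  letI := Algebra.compHom (Module.End K (M ⊗[K] N)) (algebraMap ℚ K)
  have he : IsNilpotent e := L.isNilpotent_of_hasLefschetzProperty hgr
  have he' : IsNilpotent e' := L'.isNilpotent_of_hasLefschetzProperty hgr'
  have hf : IsNilpotent (L.dual hgr) := L.isNilpotent_dual hgr
  have hf' : IsNilpotent (L'.dual hgr') := L'.isNilpotent_dual hgr'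
  rw [weylOperator_def, weylOperator_def, weylOperator_def, L.dual_tensor hgr L' hgr' h0, neg_add, ← LinearMap.rTensor_neg,
    ← LinearMap.lTensor_neg, exp_rTensor_add_lTensor hf hf', exp_rTensor_add_lTensor he.neg he'.neg, ← TensorProduct.map_mul,
    ← TensorProduct.map_mul]

/-- `w_{M ⊗ N}(x ⊗ y) = w_M x ⊗ w_N y`. [cite: Andre1996Motifs, §1.3 Lemme 1.3.2 (p. 13, proof)] -/
theorem weylOperator_tensor_tmul (L : HasLefschetzProperty h e) (hgr : IsZGrading h) (L' : HasLefschetzProperty h' e')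
    (hgr' : IsZGrading h') (h0 : h.rTensor N + h'.lTensor M ≠ 0) (x : M) (y : N) :
    (L.tensor hgr L' hgr').weylOperator (isZGrading_rTensor_add_lTensor hgr hgr') (x ⊗ₜ[K] y) =
      L.weylOperator hgr x ⊗ₜ[K] L'.weylOperator hgr' y := by
  rw [L.weylOperator_tensor hgr L' hgr' h0, TensorProduct.map_tmul]

/-! ### §3 Lemme 1.3.2 (Hodge): `*_H (x ⊗ y) = (−1)^{ij} *_H x ⊗ *_H y` -/

/-- `C(n+n', 2) = C(n, 2) + n n' + C(n', 2)` (Vandermonde). [folklore] -/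
private theorem choose_two_add (n n' : ℕ) : (n + n').choose 2 = n.choose 2 + n * n' + n'.choose 2 := by
  induction n' with
  | zero => simp
  | succ n' ih =>
    rw [show n + (n' + 1) = (n + n') + 1 by ring, Nat.choose_succ_succ' (n + n') 1, Nat.choose_one_right, ih,
      Nat.choose_succ_succ' n' 1, Nat.choose_one_right]
    ring

/-- **Lemme 1.3.2 (Hodge clause): `*_{H, M⊗N} (x ⊗ y) = (−1)^{n n'} · *_H x ⊗ *_H y` for `x ∈ Hⁿ(X) = M_{n−d}`, `y ∈ H^{n'}(Y) = N_{n'−d'}`**,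
the tensor product carrying `d + d'` ("`d` remplacé par `d + d'`") — via g31-#1 (`*_H = (−1)^{d + C(n,2)} w` on `Hⁿ`), the
group-likeness `w_{M⊗N} = w ⊗ w'` and `C(n+n', 2) = C(n, 2) + n n' + C(n', 2)`; `depth M ≤ d`, `depth N ≤ d'` (all strings of co-length
`≤ d`, `≤ d'`, automatic for `H*(X)`, `H*(Y)`). [cite: Andre1996Motifs, §1.3 Lemme 1.3.2 (p. 13: "Pour l'involution de Hodge, on a la formule *_H x ⊗ *_H y = (−1)^{ij} *_H(x ⊗ y)")] -/
theorem andreHodgeInvolution_tensor_tmul (L : HasLefschetzProperty h e) (hgr : IsZGrading h) (L' : HasLefschetzProperty h' e')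
    (hgr' : IsZGrading h') (h0 : h.rTensor N + h'.lTensor M ≠ 0) {d d' : ℕ} (hd : depth h ≤ d) (hd' : depth h' ≤ d')
    {m m' : ℤ} {n n' : ℕ} (hn : (n : ℤ) = m + d) (hn' : (n' : ℤ) = m' + d') {x : M} {y : N} (hx : x ∈ degreeSpace h m)
    (hy : y ∈ degreeSpace h' m') :
    (L.tensor hgr L' hgr').andreHodgeInvolution (isZGrading_rTensor_add_lTensor hgr hgr') (d + d') (x ⊗ₜ[K] y) =
      ((-1 : K) ^ (n * n')) • (L.andreHodgeInvolution hgr d x ⊗ₜ[K] L'.andreHodgeInvolution hgr' d' y) := by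
  have hxy : x ⊗ₜ[K] y ∈ degreeSpace (h.rTensor N + h'.lTensor M) (m + m') := tmul_mem_degreeSpace hx hy
  have hdT : depth (h.rTensor N + h'.lTensor M) ≤ d + d' := (L.depth_rTensor_add_lTensor_le hgr L' hgr').trans (add_le_add hd hd')
  rw [(L.tensor hgr L' hgr').andreHodgeInvolution_apply_of_mem_degreeSpace (isZGrading_rTensor_add_lTensor hgr hgr') hdT
      (n := n + n') (by push_cast; omega) hxy,
    L.weylOperator_tensor_tmul hgr L' hgr' h0, L.andreHodgeInvolution_apply_of_mem_degreeSpace hgr hd hn hx,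
    L'.andreHodgeInvolution_apply_of_mem_degreeSpace hgr' hd' hn' hy, TensorProduct.tmul_smul, ← TensorProduct.smul_tmul', smul_smul,
    smul_smul]
  congr 1
  rw [← pow_add, ← pow_add, choose_two_add]
  congr 1
  ring

/-- **THE PRINTED FORM: `*_H x ⊗ *_H y = (−1)^{n n'} · *_{H, M⊗N}(x ⊗ y)`** for `x ∈ Hⁿ(X)`, `y ∈ H^{n'}(Y)`.
[cite: Andre1996Motifs, §1.3 Lemme 1.3.2 (p. 13)] -/
theorem andreHodgeInvolution_tmul_andreHodgeInvolution (L : HasLefschetzProperty h e) (hgr : IsZGrading h)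
    (L' : HasLefschetzProperty h' e') (hgr' : IsZGrading h') (h0 : h.rTensor N + h'.lTensor M ≠ 0) {d d' : ℕ} (hd : depth h ≤ d)
    (hd' : depth h' ≤ d') {m m' : ℤ} {n n' : ℕ} (hn : (n : ℤ) = m + d) (hn' : (n' : ℤ) = m' + d') {x : M} {y : N}
    (hx : x ∈ degreeSpace h m) (hy : y ∈ degreeSpace h' m') :
    L.andreHodgeInvolution hgr d x ⊗ₜ[K] L'.andreHodgeInvolution hgr' d' y =
      ((-1 : K) ^ (n * n')) •
        (L.tensor hgr L' hgr').andreHodgeInvolution (isZGrading_rTensor_add_lTensor hgr hgr') (d + d') (x ⊗ₜ[K] y) := by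
  rw [L.andreHodgeInvolution_tensor_tmul hgr L' hgr' h0 hd hd' hn hn' hx hy, smul_smul, ← pow_add, ← two_mul, pow_mul, neg_one_sq,
    one_pow, one_smul]

/-- **Lemme 1.3.1 (Hodge clause): on the strings through `P_{-a} ⊗ P_{-b}` the Hodge involution of `M ⊗ N` (for `d + d'`) and
`(−1)^{ij} *_{H,M} ⊗ *_{H,N}` coincide, `i = d − a`, `j = d' − b` the degrees of the primitive classes** (`a ≤ d`, `b ≤ d'`): for
`x = e^{a'} p`, `y = e'^{b'} q` the degrees are `n = i + 2a'`, `n' = j + 2b'` and `n n' ≡ i j (mod 2)`.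
[cite: Andre1996Motifs, §1.3 Lemme 1.3.1 (p. 13: "resp. (−1)^{ij} *_{H,X} ⊗ *_{H,Y}")] -/
theorem andreHodgeInvolution_tensor_apply_pow_primitive (L : HasLefschetzProperty h e) (hgr : IsZGrading h)
    (L' : HasLefschetzProperty h' e') (hgr' : IsZGrading h') (h0 : h.rTensor N + h'.lTensor M ≠ 0) {d d' : ℕ} (hd : depth h ≤ d)
    (hd' : depth h' ≤ d') {a b : ℕ} (ha : a ≤ d) (hb : b ≤ d') {p : M} {q : N} (hp : p ∈ primitiveSpace h e a)
    (hq : q ∈ primitiveSpace h' e' b) (a' b' : ℕ) :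
    (L.tensor hgr L' hgr').andreHodgeInvolution (isZGrading_rTensor_add_lTensor hgr hgr') (d + d')
        ((e ^ a') p ⊗ₜ[K] (e' ^ b') q) =
      ((-1 : K) ^ ((d - a) * (d' - b))) •
        (L.andreHodgeInvolution hgr d ((e ^ a') p) ⊗ₜ[K] L'.andreHodgeInvolution hgr' d' ((e' ^ b') q)) := by
  rw [L.andreHodgeInvolution_tensor_tmul hgr L' hgr' h0 hd hd' (m := -(a : ℤ) + 2 * a') (m' := -(b : ℤ) + 2 * b')
    (n := d - a + 2 * a') (n' := d' - b + 2 * b') (by push_cast [Nat.cast_sub ha]; ring) (by push_cast [Nat.cast_sub hb]; ring)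
    (L.pow_apply_mem (mem_primitiveSpace_iff.1 hp).1 a') (L'.pow_apply_mem (mem_primitiveSpace_iff.1 hq).1 b')]
  congr 1
  rw [show (d - a + 2 * a') * (d' - b + 2 * b') = (d - a) * (d' - b) + 2 * (a' * (d' - b) + (d - a) * b' + 2 * a' * b') by ring,
    pow_add, pow_mul (-1 : K) 2 (a' * (d' - b) + (d - a) * b' + 2 * a' * b'), neg_one_sq, one_pow, mul_one]

end HasLefschetzProperty

end Literature.Algebra.Lie
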